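import Literature.AlgebraicTopology.KTheory.BottGL
import Literature.AlgebraicTopology.KTheory.BottLaurent
import Literature.AlgebraicTopology.KTheory.PencilProjection
import Mathlib.Topology.ContinuousMap.Units
import Mathlib.Topology.Instances.Matrix
import HarnessLib

/-!
# Spectral projections of linear clutching matrices: `[θ, za + b] = [ζ₊, z] + pr₁^*[ζ₋]` (Husemöller, *Fibre Bundles*, Ch. 11 §4)

For `a, b ∈ M_ι(C(X, ℂ))` such that the *linear clutching matrix* `linClutch a b = z a(x) + b(x)`
is invertible over `X × S¹`, the pencil `w a(x) + b(x)` is regular at every `x`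
(`isRegular_of_isUnit_linClutch`), so the pointwise spectral projections of
`PencilProjection.lean` assemble to a continuous idempotent matrix `specProj a b` over `X`
(Husemöller 11 Prop. 4.3: the bundle `ζ₊ = im P₀`). The pointwise-invertible homotopy
`specHomotopy` (Husemöller 11 Prop. 4.6, `p^t = (za + tb)P₀ + (tza + b)(1 - P₀)`) runs from
`z a + b` (`t = 1`) to `z a P₀ + b(1 - P₀) = c · (z P₀ + (1 - P₀))` (`t = 0`) with the unit
`c = a P₀ + b(1 - P₀)` over `X`; units over the base do not change Bott classes
(`bottClassGL_baseUnit_mul`), whence the **decomposition theorem**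
`bottClassGL_linClutch : [θ, za + b] = [ζ₊, z] + pr₁^*[ζ₊ᶜ]` (Husemöller 11 Props. 4.6–4.7).
Also: evaluation calculus `evalAt` for matrices of functions, points of the overlap with
prescribed coordinate (`ovlPt`), the clutching function `zClutch ζ = z · id_{im π^*ζ}`.

Everything is proved; no named facts.

## References

* D. Husemöller, *Fibre Bundles*, 3rd ed. (1994) [HusemollerFibreBundles1994]: Ch. 11 §4,
  (4.2), Props. 4.3, 4.5, 4.6, Notation 4.7; Cor. 2.8.
-/

noncomputable section

open Set Metric unitInterval Complex

namespace Literature.AlgebraicTopology.KTheory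

open Literature.RingTheory.KTheory Matrix Pencil

universe u

variable {X : Type u} [TopologicalSpace X]
variable {ι : Type} [Fintype ι] [DecidableEq ι]

/-! ### Evaluation of matrices of functions -/

/-- The value of a matrix of functions at a point (via `evalRingHom` of `Basic.lean`). [folklore] -/
abbrev evalAt {Y : Type*} [TopologicalSpace Y] {m n : Type*} (M : Matrix m n C(Y, ℂ)) (y : Y) : Matrix m n ℂ := M.map (evalRingHom y)

omit [Fintype ι] [DecidableEq ι] in
/-- Auxiliary statement for spectral projections of linear clutching matrices. [folklore] -/
theorem continuous_evalAt {Y : Type*} [TopologicalSpace Y] (M : Matrix ι ι C(Y, ℂ)) : Continuous fun y ↦ evalAt M y :=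
  continuous_matrix fun i j ↦ (M i j).continuous

/-- A matrix of functions with invertible values is invertible. [folklore] -/
theorem isUnit_of_forall_isUnit_evalAt {Y : Type*} [TopologicalSpace Y] (M : Matrix ι ι C(Y, ℂ)) (h : ∀ y, IsUnit (evalAt M y)) :
    IsUnit M := by
  rw [Matrix.isUnit_iff_isUnit_det, ContinuousMap.isUnit_iff_forall_isUnit]
  intro y
  have := (Matrix.isUnit_iff_isUnit_det _).1 (h y)
  change IsUnit ((evalRingHom y).mapMatrix M).det at this
  rwa [← RingHom.map_det] at this

/-- The values of an invertible matrix of functions are invertible. [folklore] -/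
theorem isUnit_evalAt {Y : Type*} [TopologicalSpace Y] {M : Matrix ι ι C(Y, ℂ)} (h : IsUnit M) (y : Y) : IsUnit (evalAt M y) :=
  h.map (evalRingHom y).mapMatrix

/-! ### Points of the equator with prescribed coordinate -/

/-- The vector `(Re w, Im w, 0)`. [folklore] -/
def eqVec (w : ℂ) : E3 := w.re • EuclideanSpace.single 0 1 + w.im • EuclideanSpace.single 1 1

/-- Auxiliary statement for spectral projections of linear clutching matrices. [folklore] -/
@[simp] theorem eqVec_apply_zero (w : ℂ) : eqVec w 0 = w.re := by simp [eqVec]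
/-- Auxiliary statement for spectral projections of linear clutching matrices. [folklore] -/
@[simp] theorem eqVec_apply_one (w : ℂ) : eqVec w 1 = w.im := by simp [eqVec]
/-- Auxiliary statement for spectral projections of linear clutching matrices. [folklore] -/
@[simp] theorem eqVec_apply_two (w : ℂ) : eqVec w 2 = 0 := by simp [eqVec]

/-- Auxiliary statement for spectral projections of linear clutching matrices. [folklore] -/
theorem norm_eqVec (w : ℂ) : ‖eqVec w‖ = ‖w‖ := by
  rw [EuclideanSpace.norm_eq, Fin.sum_univ_three, eqVec_apply_zero, eqVec_apply_one, eqVec_apply_two,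
    Complex.norm_eq_sqrt_sq_add_sq]
  simp [Real.norm_eq_abs, sq_abs]

/-- The point of the equator with complex coordinate `w`, `|w| = 1`. [folklore] -/
def eqPt (w : ℂ) (hw : ‖w‖ = 1) : S2r := ⟨eqVec w, by rw [mem_sphere_zero_iff_norm, norm_eqVec, hw]⟩

/-- Auxiliary statement for spectral projections of linear clutching matrices. [folklore] -/
theorem eqPt_mem_Eqt (w : ℂ) (hw : ‖w‖ = 1) : eqPt w hw ∈ Eqt := by
  rw [mem_Eqt_iff]; exact eqVec_apply_two w

/-- Auxiliary statement for spectral projections of linear clutching matrices. [folklore] -/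
theorem zc_eqPt (w : ℂ) (hw : ‖w‖ = 1) : zc (eqPt w hw) = w := by
  rw [zc_apply]
  change ((eqVec w 0 : ℝ) : ℂ) + ((eqVec w 1 : ℝ) : ℂ) * Complex.I = w
  rw [eqVec_apply_zero, eqVec_apply_one, Complex.re_add_im]

/-- The point `(x, w)` of the overlap `X × S¹`. [folklore] -/
def ovlPt (x : X) (w : ℂ) (hw : ‖w‖ = 1) : ↥(pieceUp X ∩ pieceDn X) :=
  ⟨(x, eqPt w hw), ⟨mem_univ _, (eqPt_mem_Eqt w hw).1⟩, ⟨mem_univ _, (eqPt_mem_Eqt w hw).2⟩⟩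

/-- Auxiliary statement for spectral projections of linear clutching matrices. [folklore] -/
@[simp] theorem zA_ovlPt (x : X) (w : ℂ) (hw : ‖w‖ = 1) : zA (ovlPt x w hw) = w := zc_eqPt w hw
/-- Auxiliary statement for spectral projections of linear clutching matrices. [folklore] -/
@[simp] theorem πA_ovlPt (x : X) (w : ℂ) (hw : ‖w‖ = 1) : πA (ovlPt x w hw) = x := rfl

/-! ### Lifting matrices over `X` to the overlaps; evaluation rules -/

/-- `M ↦ π^* M` over `X × S¹`. [folklore] -/
abbrev liftA (M : Matrix ι ι C(X, ℂ)) : Matrix ι ι C(↥(pieceUp X ∩ pieceDn X), ℂ) := M.map (comapRingHom πA)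

/-- `M ↦ (π ∘ (fst × id))^* M` over `(X × [0,1]) × S¹`. [folklore] -/
abbrev liftA' (M : Matrix ι ι C(X, ℂ)) : Matrix ι ι C(↥(pieceUp (X × I) ∩ pieceDn (X × I)), ℂ) :=
  (liftA M).map (comapRingHom fstOverlap)

omit [Fintype ι] [DecidableEq ι] in
/-- Matrices of functions are determined by their values. [folklore] -/
theorem ext_evalAt {Y : Type*} [TopologicalSpace Y] {M N : Matrix ι ι C(Y, ℂ)} (h : ∀ y, evalAt M y = evalAt N y) : M = N := by
  ext i j y
  exact congrFun (congrFun (h y) i) j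

section EvalRules

variable {Y : Type*} [TopologicalSpace Y] (M N : Matrix ι ι C(Y, ℂ)) (y : Y)

omit [DecidableEq ι] in
/-- Auxiliary statement for spectral projections of linear clutching matrices. [folklore] -/
theorem evalAt_mul : evalAt (M * N) y = evalAt M y * evalAt N y := Matrix.map_mul
omit [Fintype ι] [DecidableEq ι] in
/-- Auxiliary statement for spectral projections of linear clutching matrices. [folklore] -/
theorem evalAt_add : evalAt (M + N) y = evalAt M y + evalAt N y := by
  ext i j; simp [evalAt]
omit [Fintype ι] [DecidableEq ι] in
/-- Auxiliary statement for spectral projections of linear clutching matrices. [folklore] -/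
theorem evalAt_sub : evalAt (M - N) y = evalAt M y - evalAt N y := by
  ext i j; simp [evalAt]
omit [Fintype ι] in
/-- Auxiliary statement for spectral projections of linear clutching matrices. [folklore] -/
theorem evalAt_one : evalAt (1 : Matrix ι ι C(Y, ℂ)) y = 1 := Matrix.map_one _ (map_zero _) (map_one _)
omit [Fintype ι] [DecidableEq ι] in
/-- Auxiliary statement for spectral projections of linear clutching matrices. [folklore] -/
theorem evalAt_smul (f : C(Y, ℂ)) : evalAt (f • M) y = f y • evalAt M y := Matrix.map_smul' _ _ _ (map_mul _)
omit [Fintype ι] [DecidableEq ι] in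
/-- Auxiliary statement for spectral projections of linear clutching matrices. [folklore] -/
theorem evalAt_map {Y' : Type*} [TopologicalSpace Y'] (F : C(Y', Y)) (y' : Y') :
    evalAt (M.map (comapRingHom F)) y' = evalAt M (F y') := by
  change (M.map _).map _ = _
  rw [Matrix.map_map]; rfl

end EvalRules

omit [Fintype ι] [DecidableEq ι] in
/-- Auxiliary statement for spectral projections of linear clutching matrices. [folklore] -/
theorem evalAt_liftA (M : Matrix ι ι C(X, ℂ)) (z : ↥(pieceUp X ∩ pieceDn X)) : evalAt (liftA M) z = evalAt M z.1.1 :=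
  evalAt_map M πA z

omit [Fintype ι] [DecidableEq ι] in
/-- Auxiliary statement for spectral projections of linear clutching matrices. [folklore] -/
theorem evalAt_liftA' (M : Matrix ι ι C(X, ℂ)) (z : ↥(pieceUp (X × I) ∩ pieceDn (X × I))) : evalAt (liftA' M) z = evalAt M z.1.1.1 := by
  rw [liftA', evalAt_map, evalAt_liftA]; rfl

/-! ### Linear clutching matrices and their spectral projections -/

/-- **The linear clutching matrix `z a(x) + b(x)`** over `X × S¹`. [cite: HusemollerFibreBundles1994, Ch. 11 Notation 4.2] -/
def linClutch (a b : Matrix ι ι C(X, ℂ)) : Matrix ι ι C(↥(pieceUp X ∩ pieceDn X), ℂ) :=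
  (zA : C(↥(pieceUp X ∩ pieceDn X), ℂ)) • liftA a + liftA b

omit [Fintype ι] [DecidableEq ι] in
/-- Auxiliary statement for spectral projections of linear clutching matrices. [folklore] -/
theorem evalAt_linClutch (a b : Matrix ι ι C(X, ℂ)) (z : ↥(pieceUp X ∩ pieceDn X)) :
    evalAt (linClutch a b) z = pencil (evalAt a z.1.1) (evalAt b z.1.1) (zA z) := by
  rw [linClutch, evalAt_add, evalAt_smul, evalAt_liftA, evalAt_liftA, pencil]

/-- **An invertible linear clutching matrix is a regular pencil at every point.** [cite: HusemollerFibreBundles1994, Ch. 11 Notation 4.2] -/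
theorem isRegular_of_isUnit_linClutch {a b : Matrix ι ι C(X, ℂ)} (h : IsUnit (linClutch a b)) (x : X) :
    IsRegular (evalAt a x) (evalAt b x) := fun w hw ↦ by
  have := isUnit_evalAt h (ovlPt x w hw)
  rwa [evalAt_linClutch, zA_ovlPt] at this

/-- **The spectral projection `P₀(x)` as a matrix of continuous functions** (Husemöller, Ch. 11
Prop. 4.3: "the vector bundle `p₀`"). [cite: HusemollerFibreBundles1994, Ch. 11 Prop. 4.3] -/
def specProj (a b : Matrix ι ι C(X, ℂ)) (hreg : ∀ x, IsRegular (evalAt a x) (evalAt b x)) : Matrix ι ι C(X, ℂ) :=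
  Matrix.of fun i j ↦ ⟨fun x ↦ P0 (evalAt a x) (evalAt b x) i j,
    (continuous_P0_family (continuous_evalAt a) (continuous_evalAt b) hreg).matrix_elem i j⟩

/-- Auxiliary statement for spectral projections of linear clutching matrices. [folklore] -/
theorem evalAt_specProj (a b : Matrix ι ι C(X, ℂ)) (hreg : ∀ x, IsRegular (evalAt a x) (evalAt b x)) (x : X) :
    evalAt (specProj a b hreg) x = P0 (evalAt a x) (evalAt b x) := rfl

/-- `P₀² = P₀` over `X`. [cite: HusemollerFibreBundles1994, Ch. 11 Prop. 4.3] -/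
theorem isIdempotentElem_specProj (a b : Matrix ι ι C(X, ℂ)) (hreg : ∀ x, IsRegular (evalAt a x) (evalAt b x)) :
    IsIdempotentElem (specProj a b hreg) :=
  ext_evalAt fun x ↦ by rw [evalAt_mul, evalAt_specProj, (hreg x).P0_mul_P0]

/-! ### The homotopy `p^t = (za + tb) P₀ + (tza + b)(1 - P₀)` over `(X × [0,1]) × S¹` -/

section Homotopy

/-- The coordinate `z` on `(X × [0,1]) × S¹`. [folklore] -/
abbrev zA' : C(↥(pieceUp (X × I) ∩ pieceDn (X × I)), ℂ) := zA

/-- The parameter `s` on `(X × [0,1]) × S¹`. [folklore] -/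
abbrev sA' : C(↥(pieceUp (X × I) ∩ pieceDn (X × I)), ℂ) := sCoord

/-- The homotopy matrix `G = (z a + s b) P + ((s z) a + b)(1 - P)` over `(X × [0,1]) × S¹`.
[cite: HusemollerFibreBundles1994, Ch. 11 Prop. 4.6] -/
def specHomotopy (a b P : Matrix ι ι C(X, ℂ)) : Matrix ι ι C(↥(pieceUp (X × I) ∩ pieceDn (X × I)), ℂ) :=
  ((zA' (X := X)) • liftA' a + (sA' (X := X)) • liftA' b) * liftA' P +
    (((sA' (X := X)) * zA') • liftA' a + liftA' b) * (1 - liftA' P)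

/-- Auxiliary statement for spectral projections of linear clutching matrices. [folklore] -/
theorem evalAt_specHomotopy (a b P : Matrix ι ι C(X, ℂ)) (z : ↥(pieceUp (X × I) ∩ pieceDn (X × I))) :
    evalAt (specHomotopy a b P) z =
      ((zc z.1.2) • evalAt a z.1.1.1 + ((z.1.1.2 : ℝ) : ℂ) • evalAt b z.1.1.1) * evalAt P z.1.1.1 +
        ((((z.1.1.2 : ℝ) : ℂ) * zc z.1.2) • evalAt a z.1.1.1 + evalAt b z.1.1.1) * (1 - evalAt P z.1.1.1) := by
  simp only [specHomotopy, evalAt_add, evalAt_mul, evalAt_sub, evalAt_smul, evalAt_one, evalAt_liftA']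
  rfl

/-- **The homotopy matrix is invertible** when `P = P₀` (pointwise Husemöller 4.6). [cite: HusemollerFibreBundles1994, Ch. 11 Prop. 4.6] -/
theorem isUnit_specHomotopy (a b : Matrix ι ι C(X, ℂ)) (hreg : ∀ x, IsRegular (evalAt a x) (evalAt b x)) :
    IsUnit (specHomotopy a b (specProj a b hreg)) := by
  refine isUnit_of_forall_isUnit_evalAt _ fun z ↦ ?_
  rw [evalAt_specHomotopy, evalAt_specProj]
  have hz : ‖zc z.1.2‖ = 1 := by
    have hmem : z.1.2 ∈ Eqt := ⟨z.2.1.2, z.2.2.2⟩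
    exact norm_zc_of_mem_Eqt hmem
  exact (hreg z.1.1.1).isUnit_homotopy z.1.1.2.2.1 z.1.1.2.2.2 hz

omit [TopologicalSpace X] in
/-- Auxiliary statement for spectral projections of linear clutching matrices. [folklore] -/
@[simp] theorem sliceOverlap_fst_fst_fst [TopologicalSpace X] (t : I) (z : ↥(pieceUp X ∩ pieceDn X)) :
    ((sliceOverlap t z : ↥(pieceUp (X × I) ∩ pieceDn (X × I))) : (X × I) × S2r).1.1 = z.1.1 := rfl

omit [TopologicalSpace X] in
/-- Auxiliary statement for spectral projections of linear clutching matrices. [folklore] -/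
@[simp] theorem sliceOverlap_fst_fst_snd [TopologicalSpace X] (t : I) (z : ↥(pieceUp X ∩ pieceDn X)) :
    ((sliceOverlap t z : ↥(pieceUp (X × I) ∩ pieceDn (X × I))) : (X × I) × S2r).1.2 = t := rfl

omit [TopologicalSpace X] in
/-- Auxiliary statement for spectral projections of linear clutching matrices. [folklore] -/
@[simp] theorem sliceOverlap_fst_snd [TopologicalSpace X] (t : I) (z : ↥(pieceUp X ∩ pieceDn X)) :
    ((sliceOverlap t z : ↥(pieceUp (X × I) ∩ pieceDn (X × I))) : (X × I) × S2r).2 = z.1.2 := rfl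

/-- The `t = 1` end of the homotopy: the linear clutching matrix. [cite: HusemollerFibreBundles1994, Ch. 11 Prop. 4.6] -/
theorem specHomotopy_slice_one (a b P : Matrix ι ι C(X, ℂ)) :
    (specHomotopy a b P).map (comapRingHom (sliceOverlap 1)) = linClutch a b := by
  refine ext_evalAt fun z ↦ ?_
  rw [evalAt_map, evalAt_specHomotopy, evalAt_linClutch, pencil]
  simp only [sliceOverlap_fst_fst_fst, sliceOverlap_fst_fst_snd, sliceOverlap_fst_snd, Set.Icc.coe_one, Complex.ofReal_one,
    one_smul, one_mul]
  rw [← Matrix.mul_add, add_sub_cancel, Matrix.mul_one]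
  rfl

/-- The `t = 0` end of the homotopy: `z a P + b (1 - P)`. [cite: HusemollerFibreBundles1994, Ch. 11 Prop. 4.6] -/
theorem specHomotopy_slice_zero (a b P : Matrix ι ι C(X, ℂ)) :
    (specHomotopy a b P).map (comapRingHom (sliceOverlap 0)) =
      (zA : C(↥(pieceUp X ∩ pieceDn X), ℂ)) • (liftA a * liftA P) + liftA b * (1 - liftA P) := by
  refine ext_evalAt fun z ↦ ?_
  rw [evalAt_map, evalAt_specHomotopy]
  simp only [sliceOverlap_fst_fst_fst, sliceOverlap_fst_fst_snd, sliceOverlap_fst_snd, Set.Icc.coe_zero, Complex.ofReal_zero,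
    zero_smul, add_zero, zero_mul, zero_add, evalAt_add, evalAt_mul, evalAt_sub, evalAt_one, evalAt_smul, evalAt_liftA,
    Matrix.smul_mul]
  rfl

end Homotopy

/-! ### Left multiplication by units from the base does not change the class -/

omit [Fintype ι] [DecidableEq ι] in
/-- Auxiliary statement for spectral projections of linear clutching matrices. [folklore] -/
theorem map_πDn_map_ovl₂ (M : Matrix ι ι C(X, ℂ)) : (M.map (comapRingHom πDn)).map (ovl₂ (pieceUp X) (pieceDn X)) = liftA M := by
  rw [Matrix.map_map]; rfl

/-- **A unit `c` over `X` acting on the left does not change the Bott class**: `[θ, c g] = [θ, g]`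
(re-trivialise the piece `X × D₋` by `c`). [cite: HusemollerFibreBundles1994, Ch. 11 Prop. 4.6] -/
theorem IsClutchedGL.baseUnit_mul {m : Type*} [Fintype m] {Q : Matrix m m C(X × S2r, ℂ)} {g : Matrix ι ι C(↥(pieceUp X ∩ pieceDn X), ℂ)}
    (h : IsClutchedGL Q g) (c : Matrix ι ι C(X, ℂ)) (hc : IsUnit c) : IsClutchedGL Q (liftA c * g) := by
  obtain ⟨w, hw⟩ := h
  obtain ⟨cu, rfl⟩ := hc
  set C₂ : Matrix ι ι C(↥(pieceDn X), ℂ) := ((cu⁻¹ : (Matrix ι ι C(X, ℂ))ˣ) : Matrix ι ι C(X, ℂ)).map (comapRingHom πDn)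
  set D₂ : Matrix ι ι C(↥(pieceDn X), ℂ) := (cu : Matrix ι ι C(X, ℂ)).map (comapRingHom πDn)
  have hCD : C₂ * D₂ = 1 := by rw [← Matrix.map_mul, cu.inv_mul, Matrix.map_one _ (map_zero _) (map_one _)]
  have hDC : D₂ * C₂ = 1 := by rw [← Matrix.map_mul, cu.mul_inv, Matrix.map_one _ (map_zero _) (map_one _)]
  refine ⟨w.reframe 1 1 (Matrix.mul_one _) (Matrix.mul_one _) (by rw [Matrix.mul_one, Matrix.mul_one]) C₂ D₂ hCD hDC
    (by rw [hDC, Matrix.one_mul]), ?_⟩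
  rw [GluingWitness.g_reframe, hw, Matrix.map_one _ (map_zero _) (map_one _), Matrix.mul_one, map_πDn_map_ovl₂]

/-- `[θ, c g] = [θ, g]` for units `c` over `X` and `g` over `X × S¹`. [cite: HusemollerFibreBundles1994, Ch. 11 Prop. 4.6] -/
theorem bottClassGL_baseUnit_mul [CompactSpace X] [T2Space X] (c : Matrix ι ι C(X, ℂ)) (hc : IsUnit c)
    (g : Matrix ι ι C(↥(pieceUp X ∩ pieceDn X), ℂ)) (hg : IsUnit g) : bottClassGL (liftA c * g) = bottClassGL g := by
  obtain ⟨q, hq⟩ := exists_idem_isClutchedGL g hg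
  rw [← hq.of_eq, ← (hq.baseUnit_mul c hc).of_eq]

/-- Units over `X × S¹` lifted from `X` come from units over `X`. [folklore] -/
theorem isUnit_of_isUnit_liftA {c : Matrix ι ι C(X, ℂ)} (h : IsUnit (liftA c)) : IsUnit c := by
  refine isUnit_of_forall_isUnit_evalAt c fun x ↦ ?_
  have := isUnit_evalAt h (ovlPt x 1 (by simp))
  rwa [evalAt_liftA] at this

/-! ### The decomposition theorem -/

omit [Fintype ι] [DecidableEq ι] in
/-- The factorisation `w (A P) + B (1 - P) = (A P + B (1 - P)) (w P + (1 - P))` for an idempotent `P`. [folklore] -/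
theorem factor_identity [Fintype ι] [DecidableEq ι] (A B P : Matrix ι ι ℂ) (hP : P * P = P) (w : ℂ) :
    w • (A * P) + B * (1 - P) = (A * P + B * (1 - P)) * (w • P + (1 - P)) := by
  have h1 : P * (1 - P) = 0 := by rw [Matrix.mul_sub, Matrix.mul_one, hP, sub_self]
  have h2 : (1 - P) * P = 0 := by rw [Matrix.sub_mul, Matrix.one_mul, hP, sub_self]
  have h3 : (1 - P) * (1 - P) = 1 - P := by rw [Matrix.mul_sub, Matrix.mul_one, h2, sub_zero]
  rw [Matrix.mul_add, Matrix.add_mul, Matrix.add_mul, Matrix.mul_smul, Matrix.mul_smul, Matrix.mul_assoc, hP,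
    Matrix.mul_assoc B, h2, Matrix.mul_zero, smul_zero, add_zero, Matrix.mul_assoc, h1, Matrix.mul_zero, zero_add,
    Matrix.mul_assoc, h3]

section Main

variable [CompactSpace X] [T2Space X] {n : ℕ}

/-- The idempotent `P₀` over `X` as an `Idem`. [cite: HusemollerFibreBundles1994, Ch. 11 Prop. 4.3] -/
def specIdem (a b : Matrix (Fin n) (Fin n) C(X, ℂ)) (hreg : ∀ x, IsRegular (evalAt a x) (evalAt b x)) : Idem C(X, ℂ) :=
  ⟨n, specProj a b hreg, isIdempotentElem_specProj a b hreg⟩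

omit [CompactSpace X] [T2Space X] in
/-- Auxiliary statement for spectral projections of linear clutching matrices. [folklore] -/
@[simp] theorem specIdem_mat (a b : Matrix (Fin n) (Fin n) C(X, ℂ)) (hreg : ∀ x, IsRegular (evalAt a x) (evalAt b x)) :
    (specIdem a b hreg).mat = specProj a b hreg := rfl

/-- **The clutching function `z` on `im π^* ζ`** (`[ζ, z] = ζ ⊗ γ`). [cite: HusemollerFibreBundles1994, Ch. 11 Cor. 2.8] -/
def zClutch (ζ : Idem C(X, ℂ)) : ClutchingFn ζ where
  u := (zA : C(↥(pieceUp X ∩ pieceDn X), ℂ)) • pullA ζ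
  v := (zAbar : C(↥(pieceUp X ∩ pieceDn X), ℂ)) • pullA ζ
  hu := by
    have e1 := Matrix.mul_smul (pullA ζ) (zA : C(↥(pieceUp X ∩ pieceDn X), ℂ)) (pullA ζ)
    have e2 := Matrix.smul_mul (zA : C(↥(pieceUp X ∩ pieceDn X), ℂ)) (pullA ζ * pullA ζ) (pullA ζ)
    rw [e1, e2, (isIdempotentElem_pullA ζ).eq, (isIdempotentElem_pullA ζ).eq]
  hv := by
    have e1 := Matrix.mul_smul (pullA ζ) (zAbar : C(↥(pieceUp X ∩ pieceDn X), ℂ)) (pullA ζ)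
    have e2 := Matrix.smul_mul (zAbar : C(↥(pieceUp X ∩ pieceDn X), ℂ)) (pullA ζ * pullA ζ) (pullA ζ)
    rw [e1, e2, (isIdempotentElem_pullA ζ).eq, (isIdempotentElem_pullA ζ).eq]
  huv := by
    have e1 := Matrix.smul_mul (zA : C(↥(pieceUp X ∩ pieceDn X), ℂ)) (pullA ζ) ((zAbar : C(↥(pieceUp X ∩ pieceDn X), ℂ)) • pullA ζ)
    have e2 := Matrix.mul_smul (pullA ζ) (zAbar : C(↥(pieceUp X ∩ pieceDn X), ℂ)) (pullA ζ)
    rw [e1, e2, (isIdempotentElem_pullA ζ).eq, smul_smul, zA_mul_zAbar, one_smul]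
  hvu := by
    have e1 := Matrix.smul_mul (zAbar : C(↥(pieceUp X ∩ pieceDn X), ℂ)) (pullA ζ) ((zA : C(↥(pieceUp X ∩ pieceDn X), ℂ)) • pullA ζ)
    have e2 := Matrix.mul_smul (pullA ζ) (zA : C(↥(pieceUp X ∩ pieceDn X), ℂ)) (pullA ζ)
    rw [e1, e2, (isIdempotentElem_pullA ζ).eq, smul_smul, zAbar_mul_zA, one_smul]

omit [T2Space X] in
/-- Auxiliary statement for spectral projections of linear clutching matrices. [folklore] -/
theorem zClutch_ext (ζ : Idem C(X, ℂ)) : (zClutch ζ).ext = (zA : C(↥(pieceUp X ∩ pieceDn X), ℂ)) • pullA ζ + (1 - pullA ζ) := rfl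

/-- **Husemöller Ch. 11 Props. 4.6/4.7 in `K⁰(X × S²)`**: for an invertible linear clutching matrix
`z a(x) + b(x)` of the trivial bundle, with spectral projection `P₀` (`ζ₊ = im P₀`, `ζ₋ = ker P₀`),
`[θ, z a + b] = [ζ₊, z] + pr₁^*[ζ₋]`. Proof: the homotopy `p^t` from `z a + b` to `z a P₀ + b(1 - P₀)
= (a P₀ + b(1 - P₀)) · (z P₀ + (1 - P₀))`, the unit `a P₀ + b (1 - P₀)` over `X`, and the
reduction `[ζ₊, z] + pr₁^*[ζ₊ᶜ] = [θ, z P₀ + (1 - P₀)]`. [cite: HusemollerFibreBundles1994, Ch. 11 Prop. 4.6] -/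
theorem bottClassGL_linClutch (a b : Matrix (Fin n) (Fin n) C(X, ℂ)) (hg : IsUnit (linClutch a b)) :
    bottClassGL (linClutch a b) =
      bottClass (specIdem a b (isRegular_of_isUnit_linClutch hg)) (zClutch _) +
        pullback (prX X) (KZero.of (specIdem a b (isRegular_of_isUnit_linClutch hg)).compl) := by
  set hreg := isRegular_of_isUnit_linClutch hg
  set P := specProj a b hreg with hPdef
  have hP : P * P = P := (isIdempotentElem_specProj a b hreg).eq
  -- the homotopy
  have hG := isUnit_specHomotopy a b hreg
  have h0 := specHomotopy_slice_zero a b P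
  have h1 := specHomotopy_slice_one a b P
  have hhom := bottClassGL_eq_of_homotopy _ _ (specHomotopy a b P) hG h0 h1
  rw [← hhom]
  -- the `t = 0` end factors as `c · (z P + 1 - P)`
  set c : Matrix (Fin n) (Fin n) C(X, ℂ) := a * P + b * (1 - P)
  have hfac : (zA : C(↥(pieceUp X ∩ pieceDn X), ℂ)) • (liftA a * liftA P) + liftA b * (1 - liftA P) =
      liftA c * ((zA : C(↥(pieceUp X ∩ pieceDn X), ℂ)) • liftA P + (1 - liftA P)) := by
    refine ext_evalAt fun z ↦ ?_
    simp only [c, evalAt_add, evalAt_mul, evalAt_sub, evalAt_smul, evalAt_one, evalAt_liftA]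
    exact factor_identity _ _ _ (by rw [hPdef, evalAt_specProj]; exact (hreg z.1.1).P0_mul_P0) _
  -- the second factor is `(zClutch ζ₊).ext`
  have hext : (zA : C(↥(pieceUp X ∩ pieceDn X), ℂ)) • liftA P + (1 - liftA P) = (zClutch (specIdem a b hreg)).ext := rfl
  -- `c` is a unit
  have hslice0 : IsUnit ((zA : C(↥(pieceUp X ∩ pieceDn X), ℂ)) • (liftA a * liftA P) + liftA b * (1 - liftA P)) := by
    rw [← h0]; exact hG.map (comapRingHom (sliceOverlap (X := X) 0)).mapMatrix
  have hext_unit : IsUnit ((zA : C(↥(pieceUp X ∩ pieceDn X), ℂ)) • liftA P + (1 - liftA P)) := by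
    rw [hext]; exact ⟨⟨_, _, (zClutch _).ext_mul_extInv, (zClutch _).extInv_mul_ext⟩, rfl⟩
  have hc : IsUnit c := by
    apply isUnit_of_isUnit_liftA
    obtain ⟨eu, heu⟩ := hext_unit
    have : liftA c = ((zA : C(↥(pieceUp X ∩ pieceDn X), ℂ)) • (liftA a * liftA P) + liftA b * (1 - liftA P)) *
        ((eu⁻¹ : (Matrix (Fin n) (Fin n) C(↥(pieceUp X ∩ pieceDn X), ℂ))ˣ) : Matrix (Fin n) (Fin n) C(↥(pieceUp X ∩ pieceDn X), ℂ)) := by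
      rw [hfac, ← heu, Units.mul_inv_cancel_right]
    rw [this]; exact hslice0.mul (Units.isUnit _)
  rw [hfac, bottClassGL_baseUnit_mul c hc _ hext_unit, hext]
  exact (bottClass_add_pullback_compl (zClutch (specIdem a b hreg))).symm

end Main

end Literature.AlgebraicTopology.KTheory

end
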